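import Literature.MathematicalPhysics.QuantumFieldTheory.BorinskyMunchTellander2023.MassMomentumSpanningQuotient
import HarnessLib

/-!
# The initial form of `ℱ_G(𝒫)` on every UV face `−1_γ` is `𝒰_γ · ℱ_{G/γ}(𝒫)` — Brown 2017 Thm 2.7 (UV line) for Gram-matrix kinematics in EVERY regime, at the level of monomials — PROVED

**Sources.** F. Brown, *Feynman amplitudes, coaction principle, and cosmic Galois group*, arXiv:1512.06409 [cite: Brown2017] —
Theorem 2.7 (first line): "Let G be a connected Feynman graph, and let γ ⊂ E_G be an edge-subgraph with any number of connected
components. Then Ξ_G(q,m) = Ψ_γ Ξ_{G/γ}(q,m) + R^{Ξ,UV}_{γ,G}(q,m) where R^{Ξ,UV}_{γ,G}(q,m) has degree > h_γ in the α_e, e ∈ E_γ."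
K. Schultka, arXiv:1806.01086 [cite: Schultka2018] — Proposition 4.11 (1) ("deg_γ(R^Φ) > deg_γ(Φ_{G|γ})") and Corollary 4.12
("The face of P_G corresponding to the weight vector e^γ is F_{e^γ}P_G = P_γ × P_{G/γ}"). M. Borinsky, H. J. Munch, F. Tellander,
CPC 292 (2023) 108874 = arXiv:2302.08955 [cite: BorinskyMunchTellander2023] — §2.1 eq. (polyUF) (`ℱ` from the matrix `𝒫`), §3.3
(`ℱ_{G/γ}`), Theorems 3.5 / 3.6 (`z_ℱ(γ) = L_γ` for non-m.m. `γ`). M. Borinsky 2020 [cite: Borinsky2020] — Definition 1 (the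
truncation `p_F` to a face) and the proof of Theorem 32 ("The form of the boolean functions z_Ψ and z_Φ follows directly from the
factorization laws").

**What is typed here (all PROVED; 0 named facts).** The companions typed Brown's UV factorisation for Euclidean VECTOR momenta
(`SecondSymanzikFactorization.lean`: the polynomial identity with explicit remainder) and, for Gram-matrix kinematics `𝒫` (any
symmetric matrix with vanishing row sums — BMT23 §2.2, every regime), only its leading coefficients
(`MassMomentumSpanningQuotient.lean`: `coeff_gramSecondSymanzik_eq_coeff_quot`, `loopNumber_add_one_le_gammaDeg`). This file completes
THEOREM 2.7's UV LINE FOR `𝒫`-KINEMATICS IN EVERY REGIME at the level of monomials: (1) every monomial of `ℱ_G(𝒫)` has at least `L_γ`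
variables of `γ` (`loopNumber_le_gammaDeg`); (2) every monomial of `Ψ_γ · ℱ_{G/γ}(𝒫)` has exactly `L_γ`
(`gammaDeg_of_mem_support_kirchhoffSub_mul_quot`); (3) at every exponent with exactly `L_γ` variables of `γ` the coefficients of
`ℱ_G(𝒫)` and of `Ψ_γ · ℱ_{G/γ}(𝒫)` AGREE (`coeff_eq_coeff_mul_of_gammaDeg_eq`; the two kinds of such monomials, C1 = 2-forests `F`
with `|F ∩ γ| = rk γ` and C2 = mass monomials `x_e x^{𝟙_{E∖T}}` with `|T ∩ γ| = rk γ`, `e ∉ γ ∪ T`, via Lemma 2.1's assembly maps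
`isSpanningTwoForest_union`, `isSpanningTree_union`); hence (4) **`le_gammaDeg_of_mem_support_uv_remainder_gram`**: every monomial of
`ℱ_G(𝒫) − Ψ_γ ℱ_{G/γ}(𝒫)` has `≥ L_γ + 1` variables of `γ` — Brown's "R^{Ξ,UV} has degree > h_γ", for every symmetric conserved `𝒫`,
real masses, connected edge list, every `γ`; and (5) **`faceValue_and_trunc_gramSecondSymanzik_neg_setIndicator`**: Borinsky's
truncation of `ℱ_G(𝒫)` to the face exposed by `−1_γ` is the PRODUCT `Ψ_γ · ℱ_{G/γ}(𝒫)` with face value `−L_γ` whenever `ℱ_{G/γ}(𝒫)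
≠ 0` (Schultka's product face), in particular (6) for every non-m.m. `γ` under (generic kinematics)
(`trunc_gramSecondSymanzik_neg_setIndicator_of_not_isMassMomentumSpanningGram`). Also: the dictionary `ℱ_G = ℱ_{G/∅}`
(`gramSecondSymanzikQuot_empty`), the monomial classifications of `Ψ_γ` and of the quotient shape, and the disjoint-variables
coefficient lemma for `Ψ_γ · Q`.

**Route (disclosed).** Not the companion's bijective proof of the polynomial identity, but its coefficient-level shadow, which is
what the UV face needs: monomials of `ℱ_G(𝒫)` are among those of the Euclidean generic `Ξ_G(p̃)` (companion
`support_gramSecondSymanzik_subset` with `exists_of_mem_support_secondSymanzikPolynomial`), so they are 2-forest or (tree, edge)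
monomials and their `γ`-degrees are read off `|F ∩ γ| ≤ rk γ`; on the other side `Ψ_γ · ℱ_{G/γ}` has separated variables, so its
coefficient at `a + b` is `[x^a]Ψ_γ · [x^b]ℱ_{G/γ}` and its monomials are `𝟙_{γ∖B} + (quotient monomial)`, which Lemma 2.1 reassembles
into C1 / C2 monomials of `G`; C1 is the companion's identity, C2 is `m_e²` on both sides. The IR line (Prop. 2.4) for `𝒫` is NOT
typed here (the companion has it for vector momenta). D-0026: no new fact; private plumbing duplicated from the companions.
-/

noncomputable section

namespace Literature.MathematicalPhysics.QuantumFieldTheory.BorinskyMunchTellander2023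

open Finset MvPolynomial Matrix Matroid
open Literature.MathematicalPhysics.QuantumFieldTheory
open Literature.MathematicalPhysics.QuantumFieldTheory.Borinsky2020

variable {N V : ℕ} {E : Fin N → Fin (V + 1) × Fin (V + 1)}

/-! ## Part 1 — plumbing: exponent vectors, and coefficients of a product of polynomials in disjoint sets of variables -/

section Plumbing

/-- `(Σ_{e'∈S} 𝟙_{e'})(k) = [k ∈ S]`. Plumbing. [folklore] -/
private theorem sum_single_apply (S : Finset (Fin N)) (k : Fin N) :
    (∑ e' ∈ S, Finsupp.single e' (1 : ℕ) : Fin N →₀ ℕ) k = if k ∈ S then 1 else 0 := by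
  classical
  rw [Finsupp.coe_finsetSum, Finset.sum_apply]
  simp [Finsupp.single_apply]

/-- The support of `Σ_{e∈S} 𝟙_e` is `S`. Plumbing. [folklore] -/
private theorem support_sum_single (S : Finset (Fin N)) :
    (∑ e' ∈ S, Finsupp.single e' (1 : ℕ) : Fin N →₀ ℕ).support = S := by
  classical
  ext k
  rw [Finsupp.mem_support_iff, sum_single_apply]
  simp

/-- `S ↦ Σ_{e∈S} 𝟙_e` is injective. Plumbing. [folklore] -/
private theorem sum_single_injective {S T : Finset (Fin N)}
    (h : (∑ e' ∈ S, Finsupp.single e' (1 : ℕ) : Fin N →₀ ℕ) = ∑ e' ∈ T, Finsupp.single e' 1) : S = T := by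
  have := congrArg Finsupp.support h
  rwa [support_sum_single, support_sum_single] at this

/-- `𝟙_A + 𝟙_B = 𝟙_{A ∪ B}` for disjoint `A`, `B`. Plumbing. [folklore] -/
private theorem sum_single_add_sum_single_of_disjoint {A B : Finset (Fin N)} (h : Disjoint A B) :
    ∑ e' ∈ A, Finsupp.single e' (1 : ℕ) + ∑ e' ∈ B, Finsupp.single e' 1 = ∑ e' ∈ A ∪ B, Finsupp.single e' 1 := by
  classical
  rw [Finset.sum_union h]

/-- `deg_γ x^{𝟙_S} = |γ ∩ S|`, restated with `γ ∖ ·` for complements: `deg_γ x^{𝟙_{E∖F}} = |γ ∖ F|`. Plumbing. [folklore] -/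
private theorem gammaDeg_compl (F γ : Finset (Fin N)) :
    ∑ e ∈ γ, (∑ e' ∈ Fᶜ, Finsupp.single e' (1 : ℕ) : Fin N →₀ ℕ) e = (γ \ F).card := by
  rw [gammaDeg_sum_single, ← Finset.sdiff_eq_inter_compl]

/-- `deg_γ x^{𝟙_{E∖T} + 𝟙_e} = |γ ∖ T| + [e ∈ γ]`. Plumbing. [folklore] -/
private theorem gammaDeg_compl_add_single (T γ : Finset (Fin N)) (e : Fin N) :
    ∑ x ∈ γ, (∑ e' ∈ Tᶜ, Finsupp.single e' (1 : ℕ) + Finsupp.single e 1 : Fin N →₀ ℕ) x =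
      (γ \ T).card + if e ∈ γ then 1 else 0 := by
  classical
  simp only [Finsupp.add_apply, Finset.sum_add_distrib]
  rw [gammaDeg_compl]
  congr 1
  simp only [Finsupp.single_apply]
  rw [Finset.sum_ite_eq]

/-- The square-free exponent of the mass monomial `(T, e)` with `e ∈ T` is that of the 2-forest `T − e`. Plumbing. [folklore] -/
private theorem sum_single_compl_add_single_of_mem {T : Finset (Fin N)} {e : Fin N} (he : e ∈ T) :
    ∑ e' ∈ Tᶜ, Finsupp.single e' (1 : ℕ) + Finsupp.single e 1 = ∑ e' ∈ (T.erase e)ᶜ, Finsupp.single e' 1 := by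
  classical
  rw [Finset.compl_erase, Finset.sum_insert (fun h => (Finset.mem_compl.1 h) he), add_comm]

/-- **Coefficients of a product of polynomials in disjoint sets of variables**: if every monomial of `P` lives in the variables
of `γ` and every monomial of `Q` in those of `E ∖ γ`, then `[x^{a+b}](P·Q) = [x^a]P · [x^b]Q` for `a` supported in `γ` and `b` in
`E ∖ γ` (the only splitting of `a + b` that can contribute). Plumbing. [folklore] -/
private theorem coeff_add_mul_of_separated {γ : Finset (Fin N)} {P Q : MvPolynomial (Fin N) ℝ}
    (hP : ∀ a ∈ P.support, ∀ e ∉ γ, a e = 0) (hQ : ∀ b ∈ Q.support, ∀ e ∈ γ, b e = 0)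
    {a b : Fin N →₀ ℕ} (ha : ∀ e ∉ γ, a e = 0) (hb : ∀ e ∈ γ, b e = 0) :
    coeff (a + b) (P * Q) = coeff a P * coeff b Q := by
  classical
  rw [coeff_mul]
  refine Finset.sum_eq_single (a, b) (fun x hx hne => ?_) (fun h => (h ?_).elim)
  swap
  · rw [Finset.HasAntidiagonal.mem_antidiagonal]
  by_contra hprod
  have h1 : coeff x.1 P ≠ 0 := fun h => hprod (by rw [h, zero_mul])
  have h2 : coeff x.2 Q ≠ 0 := fun h => hprod (by rw [h, mul_zero])
  have hx' := Finset.HasAntidiagonal.mem_antidiagonal.1 hx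
  have hxa : x.1 = a := by
    ext e
    have := DFunLike.congr_fun hx' e
    rw [Finsupp.add_apply, Finsupp.add_apply] at this
    by_cases he : e ∈ γ
    · rw [hQ x.2 (mem_support_iff.2 h2) e he, hb e he] at this
      simpa using this
    · rw [hP x.1 (mem_support_iff.2 h1) e he, ha e he]
  have hxb : x.2 = b := by
    have := hx'
    rw [hxa] at this
    exact add_left_cancel this
  exact hne (Prod.ext hxa hxb)

end Plumbing

/-! ## Part 2 — the monomials of `Ψ_γ` and of the quotient shape; `ℱ_G = ℱ_{G/∅}` -/

section Shapes

open scoped Classical in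
/-- **The monomials of `Ψ_γ`**: `[x^a] Ψ_γ ≠ 0` only for `a = 𝟙_{γ∖B}`, `B` a maximal forest (basis) of `γ`.
[cite: Brown2017, Prop. 2.2 ("deg Ψ_γ = deg Π_i Ψ_{γ_i} = h_γ"); Schultka2018, §4 after Corollary 4.12 (toricfeynman.tex l.2318–2323)] -/
theorem exists_of_coeff_kirchhoffSub_ne_zero {γ : Finset (Fin N)} {a : Fin N →₀ ℕ} (ha : coeff a (kirchhoffSub E γ) ≠ 0) :
    ∃ B, B ⊆ γ ∧ (cycleMatroid E).IsBasis (↑B : Set (Fin N)) (↑γ : Set (Fin N)) ∧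
      a = ∑ e' ∈ γ \ B, Finsupp.single e' 1 := by
  by_contra hno
  push Not at hno
  apply ha
  rw [kirchhoffSub, coeff_sum]
  refine Finset.sum_eq_zero fun B hB => ?_
  have hBγ : B ⊆ γ := Finset.mem_powerset.1 (Finset.mem_filter.1 hB).1
  rw [show (∏ e ∈ γ \ B, (X e : MvPolynomial (Fin N) ℝ)) = monomial (∑ e' ∈ γ \ B, Finsupp.single e' 1) 1 by
      induction (γ \ B) using Finset.induction_on with
      | empty => simp
      | insert e S he ih =>
        rw [Finset.prod_insert he, Finset.sum_insert he, ih, ← pow_one (X e), X_pow_eq_monomial, monomial_mul, one_mul],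
    coeff_monomial]
  exact if_neg fun h => hno B hBγ (Finset.mem_filter.1 hB).2 h.symm

open scoped Classical in
/-- `[x^{𝟙_{γ∖B}}] Ψ_γ = 1` for a basis `B` of `γ` (distinct bases give distinct monomials). [cite: Brown2017, Prop. 2.2; Schultka2018, §4 after Corollary 4.12] -/
theorem coeff_kirchhoffSub_basis {γ B : Finset (Fin N)} (hBγ : B ⊆ γ)
    (hB : (cycleMatroid E).IsBasis (↑B : Set (Fin N)) (↑γ : Set (Fin N))) :
    coeff (∑ e' ∈ γ \ B, Finsupp.single e' (1 : ℕ)) (kirchhoffSub E γ) = 1 := by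
  rw [kirchhoffSub, coeff_sum]
  have hmono : ∀ S : Finset (Fin N), (∏ e ∈ S, (X e : MvPolynomial (Fin N) ℝ)) =
      monomial (∑ e' ∈ S, Finsupp.single e' 1) 1 := fun S => by
    induction S using Finset.induction_on with
    | empty => simp
    | insert e S he ih =>
      rw [Finset.prod_insert he, Finset.sum_insert he, ih, ← pow_one (X e), X_pow_eq_monomial, monomial_mul, one_mul]
  simp only [hmono, coeff_monomial]
  rw [Finset.sum_eq_single_of_mem B (Finset.mem_filter.2 ⟨Finset.mem_powerset.2 hBγ, hB⟩)
    (fun B' hB' hne => if_neg fun heq => hne ?_), if_pos rfl]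
  have hB'γ : B' ⊆ γ := Finset.mem_powerset.1 (Finset.mem_filter.1 hB').1
  rw [← Finset.sdiff_sdiff_eq_self hB'γ, sum_single_injective heq, Finset.sdiff_sdiff_eq_self hBγ]

/-- Every monomial of `Ψ_γ` lives in the variables of `γ`. Private copy: the same statement is public in
`Volkov2016/OnShellDenominatorQuotientAdditivity.lean`, whose import cone (Volkov 2016 §5) is not pulled under BMT23 for it.
Plumbing. [folklore] -/
private theorem apply_eq_zero_of_mem_support_kirchhoffSub {γ : Finset (Fin N)} {a : Fin N →₀ ℕ}
    (ha : a ∈ (kirchhoffSub E γ).support) {e : Fin N} (he : e ∉ γ) : a e = 0 := by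
  classical
  obtain ⟨B, -, -, rfl⟩ := exists_of_coeff_kirchhoffSub_ne_zero (mem_support_iff.1 ha)
  rw [sum_single_apply, if_neg fun h => he (Finset.mem_sdiff.1 h).1]

open scoped Classical in
/-- **The monomials of the quotient shape**: a non-zero coefficient sits at `𝟙_{(E∖γ)∖T'}` for a spanning 2-forest `T'` of `G/γ` or at
`𝟙_{(E∖γ)∖B} + 𝟙_e` for a spanning tree `B` of `G/γ` and an edge `e ∉ γ`. [cite: BorinskyMunchTellander2023, §2.1 eq. (polyUF) with §3.3; Brown2017, Thm 2.7] -/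
theorem exists_of_coeff_quotTwoForestPolynomial_ne_zero {γ : Finset (Fin N)} {c : Finset (Fin N) → ℝ} {m : Fin N → ℝ}
    {b : Fin N →₀ ℕ} (hb : coeff b (quotTwoForestPolynomial E γ c m) ≠ 0) :
    (∃ T', T' ⊆ γᶜ ∧ (((cycleMatroid E) ／ (↑γ : Set (Fin N))).Indep (↑T' : Set (Fin N)) ∧
        T'.card + 2 + edgeRank E γ = V + 1) ∧ b = ∑ e' ∈ γᶜ \ T', Finsupp.single e' 1) ∨
      ∃ B, B ⊆ γᶜ ∧ ((cycleMatroid E) ／ (↑γ : Set (Fin N))).IsBase (↑B : Set (Fin N)) ∧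
        ∃ e ∈ γᶜ, b = ∑ e' ∈ γᶜ \ B, Finsupp.single e' 1 + Finsupp.single e 1 := by
  by_contra hno
  push Not at hno
  obtain ⟨h1, h2⟩ := hno
  apply hb
  rw [coeff_quotTwoForestPolynomial, Finset.sum_eq_zero, zero_add, Finset.sum_eq_zero]
  · intro B hB
    refine Finset.sum_eq_zero fun e he => if_neg fun h => ?_
    exact h2 B (Finset.mem_powerset.1 (Finset.mem_filter.1 hB).1) (Finset.mem_filter.1 hB).2 e he h.symm
  · intro T' hT'
    exact if_neg fun h => h1 T' (Finset.mem_powerset.1 (Finset.mem_filter.1 hT').1) (Finset.mem_filter.1 hT').2 h.symm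

/-- Every monomial of the quotient shape lives in the variables of `E ∖ γ`. [cite: Brown2017, Thm 2.7 eq. (XiUVfact)] -/
theorem apply_eq_zero_of_mem_support_quotTwoForestPolynomial {γ : Finset (Fin N)} {c : Finset (Fin N) → ℝ} {m : Fin N → ℝ}
    {b : Fin N →₀ ℕ} (hb : b ∈ (quotTwoForestPolynomial E γ c m).support) {e : Fin N} (he : e ∈ γ) : b e = 0 := by
  classical
  rcases exists_of_coeff_quotTwoForestPolynomial_ne_zero (mem_support_iff.1 hb) with
    ⟨T', -, -, rfl⟩ | ⟨B, -, -, e', he', rfl⟩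
  · rw [sum_single_apply, if_neg fun h => (Finset.mem_compl.1 (Finset.mem_sdiff.1 h).1) he]
  · rw [Finsupp.add_apply, sum_single_apply, if_neg fun h => (Finset.mem_compl.1 (Finset.mem_sdiff.1 h).1) he,
      Finsupp.single_apply, if_neg fun h => (Finset.mem_compl.1 he') (by rw [h]; exact he), add_zero]

/-- Hence every monomial of `Ψ_γ · ℱ_{G/γ}(𝒫)` (indeed of `Ψ_γ` times any quotient shape) has exactly `L_γ` variables of `γ`
("deg Ψ_γ = h_γ", the quotient factor contributing none). [cite: Brown2017, Thm 2.7 eq. (XiUVfact) and Prop. 2.2; Schultka2018, Proposition 4.11 (1)] -/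
theorem gammaDeg_of_mem_support_kirchhoffSub_mul_quot {γ : Finset (Fin N)} {c : Finset (Fin N) → ℝ} {m : Fin N → ℝ}
    {d : Fin N →₀ ℕ} (hd : d ∈ (kirchhoffSub E γ * quotTwoForestPolynomial E γ c m).support) :
    ∑ e ∈ γ, d e = loopNumber E γ := by
  classical
  obtain ⟨a, ha, b, hb, rfl⟩ := Finset.mem_add.1 (support_mul _ _ hd)
  simp only [Finsupp.add_apply, Finset.sum_add_distrib]
  rw [gammaDeg_of_mem_support_kirchhoffSub E ha,
    Finset.sum_eq_zero fun e he => apply_eq_zero_of_mem_support_quotTwoForestPolynomial hb he, add_zero]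

open scoped Classical in
/-- **`ℱ_G = ℱ_{G/∅}`**: the graph is its own quotient by the empty edge set (`M(G)/∅ = M(G)`, spanning 2-forests / trees of `G/∅` =
those of `G`, root sides and cuts unchanged) — consistency of the two typings (`gramSecondSymanzik`, `gramSecondSymanzikQuot`).
[cite: BorinskyMunchTellander2023, §2.1 eq. (polyUF) with §3.3; Oxley2011, §3.1 (M/∅ = M)] -/
theorem gramSecondSymanzikQuot_empty (hconn : IsConnectedEdgeList E) (P : Matrix (Fin (V + 1)) (Fin (V + 1)) ℝ)
    (m : Fin N → ℝ) : gramSecondSymanzikQuot E ∅ P m = gramSecondSymanzik E P m := by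
  have hrk0 : edgeRank E (∅ : Finset (Fin N)) = 0 := Nat.eq_zero_of_le_zero (by simpa using edgeRank_le_card E (∅ : Finset (Fin N)))
  unfold gramSecondSymanzikQuot gramSecondSymanzik quotTwoForestPolynomial twoForestPolynomial kirchhoffQuot
  have hfilt : (∅ : Finset (Fin N))ᶜ.powerset.filter (fun T' : Finset (Fin N) =>
      ((cycleMatroid E) ／ (↑(∅ : Finset (Fin N)) : Set (Fin N))).Indep (↑T' : Set (Fin N)) ∧
        T'.card + 2 + edgeRank E ∅ = V + 1) = univ.filter (IsSpanningTwoForest E) := by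
    ext T'
    simp only [Finset.mem_filter, Finset.mem_powerset, Finset.compl_empty, Finset.subset_univ, true_and, Finset.mem_univ,
      Finset.coe_empty, contract_empty, indep_cycleMatroid_iff_edgeRank, hrk0, IsSpanningTwoForest]
    constructor
    · rintro ⟨h1, h2⟩; exact ⟨by omega, h1⟩
    · rintro ⟨h1, h2⟩; exact ⟨h2, by omega⟩
  have hfilt' : (∅ : Finset (Fin N))ᶜ.powerset.filter (fun B : Finset (Fin N) =>
      ((cycleMatroid E) ／ (↑(∅ : Finset (Fin N)) : Set (Fin N))).IsBase (↑B : Set (Fin N))) =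
        univ.filter (IsSpanningTree E) := by
    ext B
    simp only [Finset.mem_filter, Finset.mem_powerset, Finset.compl_empty, Finset.subset_univ, true_and, Finset.mem_univ,
      Finset.coe_empty, contract_empty, isBase_cycleMatroid_iff_isSpanningTree E hconn]
  rw [hfilt, hfilt', Finset.compl_empty, kirchhoffPolynomial_eq_sum_spanningTrees E ℝ]
  congr 1
  · refine Finset.sum_congr rfl fun T' _ => ?_
    beta_reduce
    rw [Finset.empty_union, ← Finset.compl_eq_univ_sdiff]
  · congr 1
    refine Finset.sum_congr (by convert rfl) fun T _ => ?_
    rw [← Finset.compl_eq_univ_sdiff]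

/-- **The coefficient of the non-square-free mass monomial `x_e · x^{𝟙_{E∖T}}` of `ℱ_G(𝒫)` (`T` a spanning tree, `e ∉ T`) is `m_e²`**
("the coefficient of α_e² in Ξ_G is m_e² Ψ_{G∖e}", at one tree). [cite: Brown2017, Lemma 1.13 (proof); BorinskyMunchTellander2023, §2.1 eq. (polyUF)] -/
theorem coeff_gramSecondSymanzik_tree_add_single (hconn : IsConnectedEdgeList E) (P : Matrix (Fin (V + 1)) (Fin (V + 1)) ℝ)
    (m : Fin N → ℝ) {T : Finset (Fin N)} (hT : IsSpanningTree E T) {e : Fin N} (he : e ∉ T) :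
    coeff (∑ e' ∈ Tᶜ, Finsupp.single e' 1 + Finsupp.single e 1) (gramSecondSymanzik E P m) = m e ^ 2 := by
  classical
  have hbase : ((cycleMatroid E) ／ (↑(∅ : Finset (Fin N)) : Set (Fin N))).IsBase (↑T : Set (Fin N)) := by
    rw [Finset.coe_empty, contract_empty]
    exact (isBase_cycleMatroid_iff_isSpanningTree E hconn T).2 hT
  have h := coeff_quotTwoForestPolynomial_base_add_single (E := E) ∅ (fun T' => -sqMomentum P (rootSide E (∅ ∪ T'))) m
    (fun x _ => Finset.mem_compl.2 (Finset.notMem_empty x)) hbase (Finset.mem_compl.2 (Finset.notMem_empty e)) he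
  rw [Finset.compl_empty, ← Finset.compl_eq_univ_sdiff] at h
  rw [← gramSecondSymanzikQuot_empty hconn P m]
  exact h

end Shapes

/-! ## Part 3 — the two kinds of monomials with exactly `L_γ` variables of `γ`, and their coefficients in `ℱ_G` and in `Ψ_γ ℱ_{G/γ}` -/

section Leading

variable {P : Matrix (Fin (V + 1)) (Fin (V + 1)) ℝ}

/-- A basis `B` of `γ` and a spanning 2-forest `T'` of `G/γ` assemble to a spanning 2-forest `B ∪ T'` of `G` meeting `γ` in `B`
(Lemma 2.1's inverse map `(F, T') ↦ F ∪ T'`, k = 2). [cite: Brown2017, Lemma 2.1; Oxley2011, §3.1 Prop. 3.1.7] -/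
theorem isSpanningTwoForest_union {γ B T' : Finset (Fin N)} (hBγ : B ⊆ γ)
    (hB : (cycleMatroid E).IsBasis (↑B : Set (Fin N)) (↑γ : Set (Fin N))) (hT'γ : T' ⊆ γᶜ)
    (hT' : ((cycleMatroid E) ／ (↑γ : Set (Fin N))).Indep (↑T' : Set (Fin N)) ∧ T'.card + 2 + edgeRank E γ = V + 1) :
    IsSpanningTwoForest E (B ∪ T') ∧ (B ∪ T') ∩ γ = B ∧ (B ∪ T') \ γ = T' := by
  have hdisj : Disjoint B T' := Finset.disjoint_left.2 fun e heB heT => (Finset.mem_compl.1 (hT'γ heT)) (hBγ heB)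
  have hind : (cycleMatroid E).Indep (↑(B ∪ T') : Set (Fin N)) := by
    rw [Finset.coe_union, Set.union_comm]
    exact ((hB.contract_indep_iff).1 hT'.1).1
  have hcardB : B.card = edgeRank E γ := ((isBasis_cycleMatroid_iff E B γ).1 hB).2.2
  refine ⟨⟨?_, (indep_cycleMatroid_iff_edgeRank E _).1 hind⟩, ?_, ?_⟩
  · rw [Finset.card_union_of_disjoint hdisj]
    have := hT'.2
    omega
  · rw [Finset.union_inter_distrib_right, Finset.inter_eq_left.2 hBγ,
      Finset.disjoint_iff_inter_eq_empty.1 (Finset.disjoint_left.2 fun e he heγ => (Finset.mem_compl.1 (hT'γ he)) heγ),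
      Finset.union_empty]
  · rw [Finset.union_sdiff_distrib, Finset.sdiff_eq_empty_iff_subset.2 hBγ, Finset.empty_union,
      Finset.sdiff_eq_self_iff_disjoint.2 (Finset.disjoint_left.2 fun e he heγ => (Finset.mem_compl.1 (hT'γ he)) heγ)]

/-- A basis `B` of `γ` and a spanning tree `B'` of `G/γ` assemble to a spanning tree `B ∪ B'` of `G` meeting `γ` in `B` (Lemma 2.1,
k = 1). [cite: Brown2017, Lemma 2.1; Schultka2018, Proposition 4.11 proof sketch (toricfeynman.tex l.2283–2296)] -/
theorem isSpanningTree_union (hconn : IsConnectedEdgeList E) {γ B B' : Finset (Fin N)} (hBγ : B ⊆ γ)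
    (hB : (cycleMatroid E).IsBasis (↑B : Set (Fin N)) (↑γ : Set (Fin N))) (hB'γ : B' ⊆ γᶜ)
    (hB' : ((cycleMatroid E) ／ (↑γ : Set (Fin N))).IsBase (↑B' : Set (Fin N))) :
    IsSpanningTree E (B ∪ B') ∧ (B ∪ B') ∩ γ = B ∧ (B ∪ B') \ γ = B' := by
  have hdisj : Disjoint B' γ := Finset.disjoint_left.2 fun e he heγ => (Finset.mem_compl.1 (hB'γ he)) heγ
  have hT : IsSpanningTree E (B ∪ B') := by
    rw [Finset.union_comm, ← isBase_cycleMatroid_iff_isSpanningTree E hconn, ← contract_isBase_iff_of_isBasis E hB hdisj]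
    exact hB'
  refine ⟨hT, ?_, ?_⟩
  · rw [Finset.union_inter_distrib_right, Finset.inter_eq_left.2 hBγ, Finset.disjoint_iff_inter_eq_empty.1 hdisj,
      Finset.union_empty]
  · rw [Finset.union_sdiff_distrib, Finset.sdiff_eq_empty_iff_subset.2 hBγ, Finset.empty_union,
      Finset.sdiff_eq_self_iff_disjoint.2 hdisj]

/-- `𝟙_{E∖F} = 𝟙_{γ∖(F∩γ)} + 𝟙_{(E∖γ)∖(F∖γ)}` — the splitting of a 2-forest exponent into its `γ`-part and its `E∖γ`-part.
Plumbing. [folklore] -/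
private theorem sum_single_compl_eq_add (F γ : Finset (Fin N)) :
    ∑ e' ∈ Fᶜ, Finsupp.single e' (1 : ℕ) =
      ∑ e' ∈ γ \ (F ∩ γ), Finsupp.single e' 1 + ∑ e' ∈ γᶜ \ (F \ γ), Finsupp.single e' 1 := by
  classical
  rw [sum_single_add_sum_single_of_disjoint
    (Finset.disjoint_left.2 fun e h1 h2 => (Finset.mem_compl.1 (Finset.mem_sdiff.1 h2).1) (Finset.mem_sdiff.1 h1).1)]
  congr 1
  ext e
  simp only [Finset.mem_compl, Finset.mem_union, Finset.mem_sdiff, Finset.mem_inter]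
  by_cases heγ : e ∈ γ <;> by_cases heF : e ∈ F <;> simp [heγ, heF]

/-- **(C1) A 2-forest monomial with exactly `L_γ` variables of `γ` has the same coefficient in `ℱ_G(𝒫)` and in `Ψ_γ · ℱ_{G/γ}(𝒫)`**:
for a spanning 2-forest `F` with `|F ∩ γ| = rk γ`, both equal `[x^{𝟙_{(E∖γ)∖(F∖γ)}}] ℱ_{G/γ}(𝒫)` (the companion's coefficient-level UV
factorisation, and `[x^{𝟙_{γ∖(F∩γ)}}] Ψ_γ = 1`). [cite: Brown2017, Thm 2.7 eq. (XiUVfact) with Lemma 2.1; Schultka2018, Proposition 4.11 proof sketch] -/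
theorem coeff_twoForest_eq_coeff_mul (hconn : IsConnectedEdgeList E) (P : Matrix (Fin (V + 1)) (Fin (V + 1)) ℝ)
    (m : Fin N → ℝ) {F γ : Finset (Fin N)} (hF : IsSpanningTwoForest E F) (hcard : (F ∩ γ).card = edgeRank E γ) :
    coeff (∑ e' ∈ Fᶜ, Finsupp.single e' 1) (gramSecondSymanzik E P m) =
      coeff (∑ e' ∈ Fᶜ, Finsupp.single e' 1) (kirchhoffSub E γ * gramSecondSymanzikQuot E γ P m) := by
  classical
  have hB := isBasis_inter_of_card_eq hF.2 hcard
  rw [coeff_gramSecondSymanzik_eq_coeff_quot hconn P m hF hcard, sum_single_compl_eq_add F γ, gramSecondSymanzikQuot,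
    coeff_add_mul_of_separated (fun a ha e he => apply_eq_zero_of_mem_support_kirchhoffSub ha he)
      (fun b hb e he => apply_eq_zero_of_mem_support_quotTwoForestPolynomial hb he)
      (fun e he => by rw [sum_single_apply, if_neg fun h => he (Finset.mem_sdiff.1 h).1])
      (fun e he => by rw [sum_single_apply, if_neg fun h => (Finset.mem_compl.1 (Finset.mem_sdiff.1 h).1) he]),
    coeff_kirchhoffSub_basis Finset.inter_subset_right hB, one_mul]

/-- **(C2) A mass monomial with exactly `L_γ` variables of `γ` has the same coefficient in `ℱ_G(𝒫)` and in `Ψ_γ · ℱ_{G/γ}(𝒫)`**: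
for a spanning tree `T` with `|T ∩ γ| = rk γ` and an edge `e ∉ T`, `e ∉ γ`, both equal `m_e²` (`T ∖ γ` is a spanning tree of
`G/γ` avoiding `e`). [cite: Brown2017, Thm 2.7 eq. (XiUVfact) with Lemma 2.1 and Lemma 1.13 (proof)] -/
theorem coeff_tree_add_single_eq_coeff_mul (hconn : IsConnectedEdgeList E) (P : Matrix (Fin (V + 1)) (Fin (V + 1)) ℝ)
    (m : Fin N → ℝ) {T γ : Finset (Fin N)} (hT : IsSpanningTree E T) (hcard : (T ∩ γ).card = edgeRank E γ) {e : Fin N}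
    (heT : e ∉ T) (heγ : e ∉ γ) :
    coeff (∑ e' ∈ Tᶜ, Finsupp.single e' 1 + Finsupp.single e 1) (gramSecondSymanzik E P m) =
      coeff (∑ e' ∈ Tᶜ, Finsupp.single e' 1 + Finsupp.single e 1) (kirchhoffSub E γ * gramSecondSymanzikQuot E γ P m) := by
  classical
  have hTind : edgeRank E T = T.card := hT.2.trans hT.1.symm
  have hB := isBasis_inter_of_card_eq hTind hcard
  have hbase : ((cycleMatroid E) ／ (↑γ : Set (Fin N))).IsBase (↑(T \ γ) : Set (Fin N)) := by
    rw [contract_isBase_iff_of_isBasis E hB Finset.sdiff_disjoint, Finset.sdiff_union_inter,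
      isBase_cycleMatroid_iff_isSpanningTree E hconn]
    exact hT
  rw [coeff_gramSecondSymanzik_tree_add_single hconn P m hT heT, sum_single_compl_eq_add T γ, add_assoc, gramSecondSymanzikQuot,
    coeff_add_mul_of_separated (fun a ha e he => apply_eq_zero_of_mem_support_kirchhoffSub ha he)
      (fun b hb e he => apply_eq_zero_of_mem_support_quotTwoForestPolynomial hb he)
      (fun x hx => by rw [sum_single_apply, if_neg fun h => hx (Finset.mem_sdiff.1 h).1])
      (fun x hx => by
        rw [Finsupp.add_apply, sum_single_apply, if_neg fun h => (Finset.mem_compl.1 (Finset.mem_sdiff.1 h).1) hx,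
          Finsupp.single_apply, if_neg fun h => heγ (by rw [h]; exact hx), add_zero]),
    coeff_kirchhoffSub_basis Finset.inter_subset_right hB, one_mul,
    coeff_quotTwoForestPolynomial_base_add_single γ _ m (fun x hx => Finset.mem_compl.2 (Finset.mem_sdiff.1 hx).2) hbase
      (Finset.mem_compl.2 heγ) (fun h => heT (Finset.mem_sdiff.1 h).1)]

/-- Every monomial of `ℱ_G(𝒫)` has at least `L_γ` variables of `γ`, for every symmetric conserved `𝒫` (the monomials are among
those of the Euclidean generic `Ξ_G(p̃)`: `x^{𝟙_{E∖F}}` with `|F ∩ γ| ≤ rk γ`, and `x_e x^{𝟙_{E∖T}}`). [cite: Brown2017, Thm 2.7 (Ξ_G = Ψ_γ Ξ_{G/γ} + R^{Ξ,UV}, deg_γ ≥ h_γ); Schultka2018, Proposition 4.11 (1)] -/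
theorem loopNumber_le_gammaDeg (hP : P.IsSymm) (hcons : ∀ u, ∑ v, P u v = 0) {m : Fin N → ℝ} (γ : Finset (Fin N))
    {d : Fin N →₀ ℕ} (hd : d ∈ (gramSecondSymanzik E P m).support) : loopNumber E γ ≤ ∑ e ∈ γ, d e := by
  classical
  have hd' := support_gramSecondSymanzik_subset hP hcons m hd
  have hrk := edgeRank_le_card E γ
  rcases exists_of_mem_support_secondSymanzikPolynomial hd' with ⟨F, hF, -, rfl⟩ | ⟨T, e, hT, -, rfl⟩
  · rw [gammaDeg_compl, loopNumber]
    have hle := card_inter_le_edgeRank hF.2 γ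
    have hsum := Finset.card_sdiff_add_card_inter γ F
    rw [Finset.inter_comm] at hsum
    omega
  · rw [gammaDeg_compl_add_single, loopNumber]
    have hle := card_inter_le_edgeRank (hT.2.trans hT.1.symm) γ
    have hsum := Finset.card_sdiff_add_card_inter γ T
    rw [Finset.inter_comm] at hsum
    split_ifs <;> omega

/-- **The `L_γ`-homogeneous part of `ℱ_G(𝒫)` in the variables of `γ` IS `Ψ_γ · ℱ_{G/γ}(𝒫)`, coefficient by coefficient**, for every
symmetric conserved `𝒫` on a connected edge list: at every exponent `d` with exactly `L_γ` variables of `γ`, `[x^d] ℱ_G(𝒫) = [x^d]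
(Ψ_γ ℱ_{G/γ}(𝒫))`. The monomials of either side with `deg_γ = L_γ` are the 2-forest monomials `x^{𝟙_{E∖F}}`, `|F ∩ γ| = rk γ`, and
the mass monomials `x_e x^{𝟙_{E∖T}}`, `|T ∩ γ| = rk γ`, `e ∉ γ ∪ T` (C1, C2). [cite: Brown2017, Thm 2.7 eq. (XiUVfact) ("Ξ_G(q,m) = Ψ_γ Ξ_{G/γ}(q,m) + R^{Ξ,UV}_{γ,G}(q,m) where R^{Ξ,UV} has degree > h_γ in the α_e, e ∈ E_γ"); Schultka2018, Proposition 4.11 (1) / Corollary 4.12] -/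
theorem coeff_eq_coeff_mul_of_gammaDeg_eq (hconn : IsConnectedEdgeList E) (hP : P.IsSymm) (hcons : ∀ u, ∑ v, P u v = 0)
    (m : Fin N → ℝ) {γ : Finset (Fin N)} {d : Fin N →₀ ℕ} (hdeg : ∑ e ∈ γ, d e = loopNumber E γ) :
    coeff d (gramSecondSymanzik E P m) = coeff d (kirchhoffSub E γ * gramSecondSymanzikQuot E γ P m) := by
  classical
  have hrk := edgeRank_le_card E γ
  by_cases hG : coeff d (gramSecondSymanzik E P m) = 0
  · by_cases hQ : coeff d (kirchhoffSub E γ * gramSecondSymanzikQuot E γ P m) = 0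
    · rw [hG, hQ]
    · -- `d = a + b`, `a` a monomial of `Ψ_γ`, `b` one of `ℱ_{G/γ}`: assemble the 2-forest / the tree of `G`
      exfalso
      set a := d.filter (· ∈ γ) with ha
      set b := d.filter (fun e => ¬ e ∈ γ) with hb
      have hab : a + b = d := Finsupp.filter_add_filter_not d (· ∈ γ)
      have ha0 : ∀ e ∉ γ, a e = 0 := fun e he => Finsupp.filter_apply_neg (· ∈ γ) d he
      have hb0 : ∀ e ∈ γ, b e = 0 := fun e he => Finsupp.filter_apply_neg (fun e => ¬ e ∈ γ) d (not_not.2 he)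
      have hQ' := hQ
      rw [← hab, gramSecondSymanzikQuot,
        coeff_add_mul_of_separated (fun a ha e he => apply_eq_zero_of_mem_support_kirchhoffSub ha he)
          (fun b hb e he => apply_eq_zero_of_mem_support_quotTwoForestPolynomial hb he) ha0 hb0] at hQ'
      have hQa : coeff a (kirchhoffSub E γ) ≠ 0 := fun h => hQ' (by rw [h, zero_mul])
      have hQb : coeff b (quotTwoForestPolynomial E γ (fun T' => -sqMomentum P (rootSide E (γ ∪ T'))) m) ≠ 0 :=
        fun h => hQ' (by rw [h, mul_zero])
      obtain ⟨B, hBγ, hB, hBa⟩ := exists_of_coeff_kirchhoffSub_ne_zero hQa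
      have hcardB : B.card = edgeRank E γ := ((isBasis_cycleMatroid_iff E B γ).1 hB).2.2
      -- in each case the two coefficients agree (C1 / C2), contradicting `hG = 0 ≠ hQ`
      have key : coeff d (gramSecondSymanzik E P m) = coeff d (kirchhoffSub E γ * gramSecondSymanzikQuot E γ P m) := by
        rcases exists_of_coeff_quotTwoForestPolynomial_ne_zero hQb with ⟨T', hT'γ, hT', hT'b⟩ | ⟨B', hB'γ, hB', e, he, heb⟩
        · -- `d = 𝟙_{E∖(B ∪ T')}`: a 2-forest monomial with `|F ∩ γ| = rk γ`
          obtain ⟨hF, hFγ, hFγ'⟩ := isSpanningTwoForest_union hBγ hB hT'γ hT'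
          have hd : d = ∑ e' ∈ (B ∪ T')ᶜ, Finsupp.single e' 1 := by
            rw [← hab, hBa, hT'b, sum_single_compl_eq_add (B ∪ T') γ, hFγ, hFγ']
          rw [hd]
          exact coeff_twoForest_eq_coeff_mul hconn P m hF (by rw [hFγ, hcardB])
        · obtain ⟨hT, hTγ, hTγ'⟩ := isSpanningTree_union hconn hBγ hB hB'γ hB'
          have heγ : e ∉ γ := Finset.mem_compl.1 he
          by_cases heB' : e ∈ B'
          · -- `d = 𝟙_{E∖(T − e)}`: again a 2-forest monomial with `|(T − e) ∩ γ| = rk γ`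
            have hF := hT.isSpanningTwoForest_erase (Finset.mem_union_right B heB')
            have hFγ : ((B ∪ B').erase e) ∩ γ = B := by
              rw [Finset.erase_inter, hTγ, Finset.erase_eq_of_notMem fun h => heγ (hBγ h)]
            have hd : d = ∑ e' ∈ ((B ∪ B').erase e)ᶜ, Finsupp.single e' 1 := by
              rw [← sum_single_compl_add_single_of_mem (Finset.mem_union_right B heB'), ← hab, hBa, heb, ← add_assoc,
                sum_single_compl_eq_add (B ∪ B') γ, hTγ, hTγ']
            rw [hd]
            exact coeff_twoForest_eq_coeff_mul hconn P m hF (by rw [hFγ, hcardB])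
          · -- `d = x_e x^{𝟙_{E∖T}}` with `e ∉ T`: C2
            have heT : e ∉ B ∪ B' := fun h => (Finset.mem_union.1 h).elim (fun h' => heγ (hBγ h')) heB'
            have hd : d = ∑ e' ∈ (B ∪ B')ᶜ, Finsupp.single e' 1 + Finsupp.single e 1 := by
              rw [← hab, hBa, heb, ← add_assoc, sum_single_compl_eq_add (B ∪ B') γ, hTγ, hTγ']
            rw [hd]
            exact coeff_tree_add_single_eq_coeff_mul hconn P m hT (by rw [hTγ, hcardB]) heT heγ
      exact hQ (by rw [← key, hG])
  · -- `d` is a monomial of `ℱ_G(𝒫)`, hence of `Ξ_G(p̃)`: a 2-forest or a (tree, massive edge) monomial with `deg_γ = L_γ`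
    have hd' := support_gramSecondSymanzik_subset hP hcons m (mem_support_iff.2 hG)
    rcases exists_of_mem_support_secondSymanzikPolynomial hd' with ⟨F, hF, -, rfl⟩ | ⟨T, e, hT, -, rfl⟩
    · rw [gammaDeg_compl, loopNumber] at hdeg
      have hle := card_inter_le_edgeRank hF.2 γ
      have hsum := Finset.card_sdiff_add_card_inter γ F
      rw [Finset.inter_comm] at hsum
      exact coeff_twoForest_eq_coeff_mul hconn P m hF (by omega)
    · by_cases heT : e ∈ T
      · rw [sum_single_compl_add_single_of_mem heT] at hdeg ⊢
        have hF := hT.isSpanningTwoForest_erase heT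
        rw [gammaDeg_compl, loopNumber] at hdeg
        have hle := card_inter_le_edgeRank hF.2 γ
        have hsum := Finset.card_sdiff_add_card_inter γ (T.erase e)
        rw [Finset.inter_comm] at hsum
        exact coeff_twoForest_eq_coeff_mul hconn P m hF (by omega)
      · rw [gammaDeg_compl_add_single, loopNumber] at hdeg
        have hTind : edgeRank E T = T.card := hT.2.trans hT.1.symm
        have hle := card_inter_le_edgeRank hTind γ
        have hsum := Finset.card_sdiff_add_card_inter γ T
        rw [Finset.inter_comm] at hsum
        by_cases heγ : e ∈ γ
        · rw [if_pos heγ] at hdeg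
          omega
        · rw [if_neg heγ, add_zero] at hdeg
          exact coeff_tree_add_single_eq_coeff_mul hconn P m hT (by omega) heT heγ

end Leading

/-! ## Part 4 — BROWN THM 2.7 (UV LINE) FOR `𝒫`: `ℱ_G(𝒫) = Ψ_γ ℱ_{G/γ}(𝒫) + R`, `deg_γ R ≥ L_γ + 1`; Borinsky's truncation / Schultka's product face -/

section UVFace

variable {P : Matrix (Fin (V + 1)) (Fin (V + 1)) ℝ}

/-- **THEOREM 2.7, UV line, for Gram-matrix kinematics in EVERY regime (Brown 2017; Schultka 2018 Prop. 4.11 (1))**: "Ξ_G(q,m) =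
Ψ_γ Ξ_{G/γ}(q,m) + R^{Ξ,UV}_{γ,G}(q,m) where R^{Ξ,UV}_{γ,G}(q,m) has degree > h_γ in the α_e, e ∈ E_γ" — for `ℱ_G(𝒫)` built by eq.
(polyUF) from ANY symmetric `𝒫` with vanishing row sums (no genericity, no sign hypothesis) and real masses on a connected edge list,
EVERY edge set `γ`: every monomial of the remainder `ℱ_G(𝒫) − Ψ_γ · ℱ_{G/γ}(𝒫)` has at least `L_γ + 1` variables of `γ`.
[cite: Brown2017, Thm 2.7 eq. (XiUVfact) (arXiv:1512.06409 §2.3); Schultka2018, Proposition 4.11 (1) (toricfeynman.tex l.2246–2255)] -/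
theorem le_gammaDeg_of_mem_support_uv_remainder_gram (hconn : IsConnectedEdgeList E) (hP : P.IsSymm)
    (hcons : ∀ u, ∑ v, P u v = 0) (m : Fin N → ℝ) (γ : Finset (Fin N)) {d : Fin N →₀ ℕ}
    (hd : d ∈ (gramSecondSymanzik E P m - kirchhoffSub E γ * gramSecondSymanzikQuot E γ P m).support) :
    loopNumber E γ + 1 ≤ ∑ e ∈ γ, d e := by
  classical
  have hne : coeff d (gramSecondSymanzik E P m) ≠ coeff d (kirchhoffSub E γ * gramSecondSymanzikQuot E γ P m) := by
    intro h
    rw [mem_support_iff, coeff_sub, h, sub_self] at hd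
    exact hd rfl
  have hdeg : ∑ e ∈ γ, d e ≠ loopNumber E γ := fun h => hne (coeff_eq_coeff_mul_of_gammaDeg_eq hconn hP hcons m h)
  rcases Finset.mem_union.1 (MvPolynomial.support_sub (Fin N) _ _ hd) with h | h
  · have := loopNumber_le_gammaDeg hP hcons γ h
    omega
  · exact absurd (gammaDeg_of_mem_support_kirchhoffSub_mul_quot h) hdeg

/-- **The initial form of `ℱ_G(𝒫)` on the UV face `−1_γ` is the PRODUCT `Ψ_γ · ℱ_{G/γ}(𝒫)`** (Borinsky's truncation `p_{F_y}`,
Definition 1, at `y = −1_γ`; Schultka Cor. 4.12: "The face of P_G corresponding to the weight vector e^γ is F_{e^γ}P_G = P_γ × P_{G/γ}"),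
face value `−L_γ`, whenever `ℱ_{G/γ}(𝒫) ≠ 0` — for every symmetric conserved `𝒫` (Euclidean, pseudo-Euclidean or Minkowski; generic or
exceptional), real masses, connected edge list, every `γ`. [cite: Brown2017, Thm 2.7 eq. (XiUVfact); Schultka2018, Proposition 4.11 (1) and Corollary 4.12 (toricfeynman.tex l.2236–2315); Borinsky2020, Definition 1 (tropical.tex l.302–306)] -/
theorem faceValue_and_trunc_gramSecondSymanzik_neg_setIndicator (hconn : IsConnectedEdgeList E) (hP : P.IsSymm)
    (hcons : ∀ u, ∑ v, P u v = 0) (m : Fin N → ℝ) {γ : Finset (Fin N)} (hq : gramSecondSymanzikQuot E γ P m ≠ 0) :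
    faceValue (gramSecondSymanzik E P m) (-setIndicator γ) = -(loopNumber E γ : ℝ) ∧
      trunc (gramSecondSymanzik E P m) (-setIndicator γ) = kirchhoffSub E γ * gramSecondSymanzikQuot E γ P m := by
  refine faceValue_eq_and_trunc_eq_of_eq_add
    (r := gramSecondSymanzik E P m - kirchhoffSub E γ * gramSecondSymanzikQuot E γ P m)
    (add_sub_cancel _ _).symm (mul_ne_zero (kirchhoffSub_ne_zero E γ) hq) (fun d hd => ?_) (fun d hd => ?_)
  · rw [pairing_neg_setIndicator, gammaDeg_of_mem_support_kirchhoffSub_mul_quot hd]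
  · rw [pairing_neg_setIndicator, neg_lt_neg_iff]
    exact_mod_cast Nat.lt_of_succ_le (le_gammaDeg_of_mem_support_uv_remainder_gram hconn hP hcons m γ hd)
/-- **If `ℱ_{G/γ}(𝒫) = 0` the UV face lies deeper**: every monomial of `ℱ_G(𝒫)` has at least `L_γ + 1` variables of `γ` (the
companion's `loopNumber_add_one_le_gammaDeg`, recovered from the remainder bound). [cite: Brown2017, Thm 2.7 eq. (XiUVfact); BorinskyMunchTellander2023, §3.3 (main.tex l.715–717)] -/
theorem loopNumber_add_one_le_gammaDeg_of_quot_eq_zero (hconn : IsConnectedEdgeList E) (hP : P.IsSymm)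
    (hcons : ∀ u, ∑ v, P u v = 0) (m : Fin N → ℝ) {γ : Finset (Fin N)} (hq : gramSecondSymanzikQuot E γ P m = 0)
    {d : Fin N →₀ ℕ} (hd : d ∈ (gramSecondSymanzik E P m).support) : loopNumber E γ + 1 ≤ ∑ e ∈ γ, d e :=
  le_gammaDeg_of_mem_support_uv_remainder_gram hconn hP hcons m γ (by rwa [hq, mul_zero, sub_zero])

/-- **Under generic kinematics the UV face of every NON-m.m. `γ` is the product face**: `ℱ_G(𝒫)|_{F_{−1_γ}} = Ψ_γ · ℱ_{G/γ}(𝒫)`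
(`ℱ_{G/γ} ≠ 0 ⟺ γ` not mass-momentum spanning, companion) — the branch `z_ℱ(γ) = L_γ` of Theorem 3.5/3.6 read on the face.
[cite: BorinskyMunchTellander2023, Theorem 3.5/3.6 (main.tex l.740–779) with §3.3; Borinsky2020, Theorem 32 (proof, tropical.tex l.1217); Brown2017, Thm 2.7] -/
theorem trunc_gramSecondSymanzik_neg_setIndicator_of_not_isMassMomentumSpanningGram (hconn : IsConnectedEdgeList E)
    (hP : P.IsSymm) (hcons : ∀ u, ∑ v, P u v = 0) {m : Fin N → ℝ} (hgen : IsGeneric P m) {γ : Finset (Fin N)}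
    (hnot : ¬ IsMassMomentumSpanningGram E P m γ) :
    trunc (gramSecondSymanzik E P m) (-setIndicator γ) = kirchhoffSub E γ * gramSecondSymanzikQuot E γ P m :=
  (faceValue_and_trunc_gramSecondSymanzik_neg_setIndicator hconn hP hcons m fun h =>
    hnot ((isMassMomentumSpanningGram_iff_gramSecondSymanzikQuot_eq_zero hconn hP hcons hgen γ).2 h)).2

end UVFace

end Literature.MathematicalPhysics.QuantumFieldTheory.BorinskyMunchTellander2023
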